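import Literature.AnabelianGeometry.AbsoluteAnabelian.AbsTopIII.Thm19KummerTower
import Literature.AnabelianGeometry.AbsoluteAnabelian.AbsTopIII.Thm19KummerContainerInjProofs
import HarnessLib

/-!
# [AbsTopIII] Thm. 1.9 (d) over towers: the (d)-rows from ONE tower per directed system (proof-only)

Mochizuki, *Topics in Absolute Anabelian Geometry III*, §1, Theorem 1.9 (d), manuscript pp. 37–38
(lit key `paper:url-5493eb38cbb7`): "`k̄_NF^× ⊆ K_{Z_NF}^× ↪ lim_{→V} H¹(Π_V, μ_Ẑ(Π_U))`".

Proof-only companion of `Thm19KummerTower.lean` (abc-iut-w5-d213; sub-DAG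
`plan/L4/SUBDAG-AbsTopIII-Thm19.md`, rows Thm19.d.r9 / r10; cell abc-iut GAP-LEDGER G-w5d213-1 / -2): the
landed binder-form results of `Thm19KummerContainerPartsProofs.lean` (p419012) and
`Thm19KummerContainerEmbeddingProofs.lean` (p419376) repackaged over the successor structure
`IntrinsicKummerModel.NFTower` — `NFTower.res_const` (restriction preserves NF-constants, DERIVED from the
base-field tower), the set halves, the embeddings, and the closers `thm19d_constants_of_tower`,
`thm19d_functionField_of_tower`, `thm19d_inj_of_tower` (abc-iut-w5-d099's
`kummerToContainer_injective_of_naturality`, p419470, over the tower) and `thm19d_of_tower` — ALL THREE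
(d)-rows `Thm19d_inj ∧ Thm19d_functionField ∧ Thm19d_constants` from abc-iut-L4-t1's named facts
`Prop_1_6_i`, `Prop_1_8_i`, `Prop_1_8_ii`, `Prop_1_6_iii_units`, `Prop_1_6_iii_ker`, `Rmk_1_5_4_i` BY NAME
and ONE tower per directed system (no row taken as hypothesis).
No definition; HONEST FRAMING: typed ≠ proved for the tower data; nothing here bears on [IUTchIII] Cor. 3.12.
-/

noncomputable section

open CategoryTheory
open scoped Classical

namespace Literature.AnabelianGeometry.AbsoluteAnabelian.AbsTopIII

universe u

namespace IntrinsicKummerModel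

namespace NFTower

variable {M : IntrinsicKummerModel.{u}} {Z : M.Curve} {ι : Type u} [Preorder ι]
  {S : CurveModel.NFComplementSystem M.toCurveModel Z ι} {Ω : Type u} [Field Ω]

/-- Restriction maps NF-constants to NF-constants (the binder `hρconst` of the set-half proofs, DERIVED
from the base-field tower). [cite: MochizukiAbsTopIII2015, Thm 1.9 (d) p.37] -/
theorem res_const (T : M.NFTower S Ω) ⦃i j : ι⦄ (h : i ≤ j) (c : (M.base (S.V i))ˣ)
    (hc : Units.map (algebraMap (M.base (S.V i)) (M.FunctionField (S.V i)) : _ →* _) c ∈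
      M.regularUnits (S.V i)) (hcNF : M.IsNFConstant (S.V i) (c : M.base (S.V i))) :
    ∃ (c' : (M.base (S.V j))ˣ)
      (hc' : Units.map (algebraMap (M.base (S.V j)) (M.FunctionField (S.V j)) : _ →* _) c' ∈
        M.regularUnits (S.V j)),
      M.IsNFConstant (S.V j) (c' : M.base (S.V j)) ∧
        T.res h (Additive.ofMul ⟨_, hc⟩) = Additive.ofMul ⟨_, hc'⟩ := by
  obtain ⟨c', hτ, hρ⟩ := T.baseEmb_res h c
  exact ⟨c', T.const_mem j c', (T.isNFConstant_iff_mem j c').2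
    (by rw [hτ]; exact (T.isNFConstant_iff_mem i c).1 hcNF), hρ⟩

/-- **"`k̄_NF^×`" = the Kummer classes of NF-constants** over a tower (set half of `Thm19d_constants`;
Prop. 1.8 (i)(ii), Prop. 1.6 (iii), Rmk. 1.5.4 (i) BY NAME). [cite: MochizukiAbsTopIII2015, Thm 1.9 (d) p.38] -/
theorem constantPart_eq_nfConstantImage (T : M.NFTower S Ω) (h18i : M.Prop_1_8_i)
    (h18ii : M.Prop_1_8_ii) (h16u : M.Prop_1_6_iii_units) (h16k : M.Prop_1_6_iii_ker)
    (h154 : Rmk_1_5_4_i.{u}) (hZ : M.IsThm19dInput Z) : M.constantPart S = M.nfConstantImage S :=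
  M.constantPart_eq_nfConstantImage S h18i h18ii h16u h16k h154 hZ T.res T.naturality T.res_const T.rich

/-- **"`K_{Z_NF}^×`" = the Kummer classes of NF-rational regular units** over a tower (set half of
`Thm19d_functionField`; Prop. 1.8 (i)(ii), Prop. 1.6 (iii), Rmk. 1.5.4 (i) BY NAME).
[cite: MochizukiAbsTopIII2015, Thm 1.9 (d) p.38] -/
theorem functionFieldPart_eq_nfRationalImage (T : M.NFTower S Ω) (h18i : M.Prop_1_8_i)
    (h18ii : M.Prop_1_8_ii) (h16u : M.Prop_1_6_iii_units) (h16k : M.Prop_1_6_iii_ker)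
    (h154 : Rmk_1_5_4_i.{u}) (hZ : M.IsThm19dInput Z) : M.functionFieldPart S = M.nfRationalImage S :=
  M.functionFieldPart_eq_nfRationalImage S h18i h18ii h16u h16k h154 hZ T.res T.naturality T.res_const
    T.rich T.isNFConstant_iff

/-- **Levelwise injectivity of the Kummer maps into the container over a tower** (row `Thm19d_inj` for
the system: abc-iut-w5-d099's `kummerToContainer_injective_of_naturality` fed with the tower's `res` /
`res_injective` / `naturality`; Prop. 1.6 (i), Rmk. 1.5.4 (i) BY NAME).
[cite: MochizukiAbsTopIII2015, Thm 1.9 (d) p.38] -/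
theorem kummerToContainer_injective [IsDirectedOrder ι] (T : M.NFTower S Ω) (hZ : M.IsThm19dInput Z)
    (h16 : M.Prop_1_6_i) (h154 : Rmk_1_5_4_i.{u}) (i : ι) :
    Function.Injective (M.kummerToContainer S i) :=
  M.kummerToContainer_injective_of_naturality S hZ h16 h154 T.res T.res_injective T.naturality i

/-- **"`k̄_NF^× ↪ lim`"** over a tower, given the levelwise injectivity of the Kummer maps into the
container (row `Thm19d_inj`). [cite: MochizukiAbsTopIII2015, Thm 1.9 (d) p.38] -/
theorem exists_constEmbedding [Nonempty ι] [IsDirectedOrder ι] (T : M.NFTower S Ω)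
    (hinjS : ∀ i : ι, Function.Injective (M.kummerToContainer S i)) :
    ∃ e : Additive (↥(M.kbarNF Z))ˣ →+ S.kummerContainer,
      Function.Injective e ∧ Set.range e = M.nfConstantImage S :=
  M.exists_constEmbedding S T.res T.naturality T.const_mem T.baseEmb T.baseEmb_res T.isNFConstant_iff_mem
    T.baseEmb_exhaust hinjS

/-- **"`K_{Z_NF}^× ↪ lim`"** over a tower, given the levelwise injectivity of the Kummer maps into the
container (row `Thm19d_inj`). [cite: MochizukiAbsTopIII2015, Thm 1.9 (d) p.38] -/
theorem exists_functionFieldEmbedding [Nonempty ι] [IsDirectedOrder ι] (T : M.NFTower S Ω)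
    (hinjS : ∀ i : ι, Function.Injective (M.kummerToContainer S i)) :
    ∃ e : Additive (M.NFFunctionField Z)ˣ →+ S.kummerContainer,
      Function.Injective e ∧ Set.range e = M.nfRationalImage S :=
  M.exists_functionFieldEmbedding S T.res T.naturality Ω T.fnEmb T.fnEmb_res T.nfEmb T.isNFRational_iff
    T.nfEmb_exhaust hinjS

end NFTower

/-! ### The (d)-rows over towers -/

/-- **`Thm19d_constants` over towers**: the NAMED statement from Prop. 1.8 (i)(ii), Prop. 1.6 (i)(iii),
Rmk. 1.5.4 (i) BY NAME and ONE tower per directed system of NF-complements.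
[cite: MochizukiAbsTopIII2015, Thm 1.9 (d) p.37] -/
theorem thm19d_constants_of_tower (M : IntrinsicKummerModel.{u}) (h18i : M.Prop_1_8_i)
    (h18ii : M.Prop_1_8_ii) (h16u : M.Prop_1_6_iii_units) (h16k : M.Prop_1_6_iii_ker)
    (h16 : M.Prop_1_6_i) (h154 : Rmk_1_5_4_i.{u})
    (hT : ∀ (Z : M.Curve), M.IsThm19dInput Z → ∀ (ι : Type u) [Preorder ι] [Nonempty ι]
      [IsDirectedOrder ι] (S : CurveModel.NFComplementSystem M.toCurveModel Z ι),
      ∃ (Ω : Type u) (_ : Field Ω), Nonempty (M.NFTower S Ω)) :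
    M.Thm19d_constants := by
  intro Z hZ ι _ _ _ S
  obtain ⟨Ω, _, ⟨T⟩⟩ := hT Z hZ ι S
  have hset := T.constantPart_eq_nfConstantImage h18i h18ii h16u h16k h154 hZ
  obtain ⟨e, he, hr⟩ := T.exists_constEmbedding (T.kummerToContainer_injective hZ h16 h154)
  exact ⟨hset, e, he, hr.trans hset.symm⟩

/-- **`Thm19d_functionField` over towers**: the NAMED statement from Prop. 1.8 (i)(ii), Prop. 1.6
(i)(iii), Rmk. 1.5.4 (i) BY NAME and ONE tower per directed system of NF-complements.
[cite: MochizukiAbsTopIII2015, Thm 1.9 (d) p.37] -/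
theorem thm19d_functionField_of_tower (M : IntrinsicKummerModel.{u}) (h18i : M.Prop_1_8_i)
    (h18ii : M.Prop_1_8_ii) (h16u : M.Prop_1_6_iii_units) (h16k : M.Prop_1_6_iii_ker)
    (h16 : M.Prop_1_6_i) (h154 : Rmk_1_5_4_i.{u})
    (hT : ∀ (Z : M.Curve), M.IsThm19dInput Z → ∀ (ι : Type u) [Preorder ι] [Nonempty ι]
      [IsDirectedOrder ι] (S : CurveModel.NFComplementSystem M.toCurveModel Z ι),
      ∃ (Ω : Type u) (_ : Field Ω), Nonempty (M.NFTower S Ω)) :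
    M.Thm19d_functionField := by
  intro Z hZ ι _ _ _ S
  obtain ⟨Ω, _, ⟨T⟩⟩ := hT Z hZ ι S
  have hset := T.functionFieldPart_eq_nfRationalImage h18i h18ii h16u h16k h154 hZ
  obtain ⟨e, he, hr⟩ := T.exists_functionFieldEmbedding (T.kummerToContainer_injective hZ h16 h154)
  exact ⟨hset, e, he, hr.trans hset.symm⟩

/-- **`Thm19d_inj` over towers**: the NAMED injectivity statement (abc-iut-w5-d099's
`thm19d_inj_of_naturality`, p419470) with its naturality hypothesis supplied by the towers.
[cite: MochizukiAbsTopIII2015, Thm 1.9 (d) p.37] -/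
theorem thm19d_inj_of_tower (M : IntrinsicKummerModel.{u}) (h16 : M.Prop_1_6_i)
    (h154 : Rmk_1_5_4_i.{u})
    (hT : ∀ (Z : M.Curve), M.IsThm19dInput Z → ∀ (ι : Type u) [Preorder ι] [Nonempty ι]
      [IsDirectedOrder ι] (S : CurveModel.NFComplementSystem M.toCurveModel Z ι),
      ∃ (Ω : Type u) (_ : Field Ω), Nonempty (M.NFTower S Ω)) :
    M.Thm19d_inj := by
  intro Z hZ ι _ _ _ S i
  obtain ⟨Ω, _, ⟨T⟩⟩ := hT Z hZ ι S
  exact T.kummerToContainer_injective hZ h16 h154 i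

/-- **Thm. 1.9 (d), "`k̄_NF^× ⊆ K_{Z_NF}^× ↪ lim`", over towers**: ALL THREE (d)-rows — injectivity, the
function-field part, the constants — from the named facts Prop. 1.6 (i)(iii), Prop. 1.8 (i)(ii),
Rmk. 1.5.4 (i) BY NAME and ONE tower per directed system of NF-complements (no row taken as hypothesis).
[cite: MochizukiAbsTopIII2015, Thm 1.9 (d) p.37] -/
theorem thm19d_of_tower (M : IntrinsicKummerModel.{u}) (h18i : M.Prop_1_8_i) (h18ii : M.Prop_1_8_ii)
    (h16u : M.Prop_1_6_iii_units) (h16k : M.Prop_1_6_iii_ker) (h16 : M.Prop_1_6_i)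
    (h154 : Rmk_1_5_4_i.{u})
    (hT : ∀ (Z : M.Curve), M.IsThm19dInput Z → ∀ (ι : Type u) [Preorder ι] [Nonempty ι]
      [IsDirectedOrder ι] (S : CurveModel.NFComplementSystem M.toCurveModel Z ι),
      ∃ (Ω : Type u) (_ : Field Ω), Nonempty (M.NFTower S Ω)) :
    M.Thm19d_inj ∧ M.Thm19d_functionField ∧ M.Thm19d_constants :=
  ⟨M.thm19d_inj_of_tower h16 h154 hT,
    M.thm19d_functionField_of_tower h18i h18ii h16u h16k h16 h154 hT,
    M.thm19d_constants_of_tower h18i h18ii h16u h16k h16 h154 hT⟩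

end IntrinsicKummerModel

end Literature.AnabelianGeometry.AbsoluteAnabelian.AbsTopIII
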